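import Literature.NumberTheory.EllipticCurves.Rank1Residual.MuLambdaCarriers
import Literature.NumberTheory.IwasawaTheory.ClassicalMuInvariant
import Literature.NumberTheory.EllipticCurves.FineSelmerIsotypicClassGroupCriterion
import Literature.NumberTheory.EllipticCurves.FineSelmerCongruentCurves
import HarnessLib

/-!
# Isotypic residual form of fine Selmer groups: `(A) ↔ μ_ρ̄(X_nr(ℚ(E[p])_∞)) = 0` for prime-to-p image

Topic `NumberTheory/EllipticCurves` (grouping namespace `CoatesSujatha2005`).  DEFINITION-ONLY file (named facts,
no proof, no `sorry`); written by the typer seat `bsd-ssimc-ty1` g0 (cell `bsd-ssimc`; supports fine_pivot's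
`stub_torsionPointFieldDescent` = S2′; no item closed).

## Source (lit want acq-11236 open; held secondaries arXiv:1306.2047, arXiv:2111.08866)

J. Coates, R. Sujatha, *Fine Selmer groups of elliptic curves over p-adic Lie extensions*, Math. Ann. 331
(2005), no. 4, 809–839.  §3 Lemma 3.8 (p. 819): «We need only verify the following lemma.  **Lemma 3.8.**
There is a canonical isomorphism `R(A/L_∞) ≅ Hom_G(Y_∞/pY_∞, A[p])`, where `Y_∞ = Gal(M_∞/L_∞)` denotes
the Galois group of the maximal unramified abelian extension `M_∞` of `L_∞`.» (Here `L = K(A[p])`, `A`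
an abelian variety; `R(A/L_∞)` is the fine Selmer group over `L_∞`.) §3 proof of Thm. 3.4 (pp. 818–822):
if `μ(X_nr(L_∞)) = 0` (unramified Iwasawa module of the division field), the Hom module
`Hom_G(X_nr/p, A[p])` is finite, so `R(A/L_∞)[p]` is finite; inflating to `R(A[p]/K_∞)` (prime-to-p
Hochschild–Serre) and applying the Lim–Sujatha lemma gives finiteness of `R(A[p^∞]/K_∞)`, which is (A).

The ISOTYPIC reading (stated explicitly in M. F. Lim, *Notes on fine Selmer groups*, arXiv:1306.2047, §3):
for `G = Gal(L/K)`, `p ∤ |G|`, and `ρ̄ : G → GL_n(𝔽_p)` absolutely irreducible,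
`Hom_G(X_nr(L_∞)/p, ρ̄) = (X_nr/p)_ρ̄` (the ρ̄-isotypic component), which is finite iff the `ρ̄`-ISOTYPIC
`μ`-invariant `μ_ρ̄(X_nr(L_∞))` vanishes.  For elliptic curves over `ℚ` with `p ∤ #Gal(ℚ(E[p])/ℚ)`
and `E[p]` irreducible: **statement (A) at `(E, p)` ⟺ `μ_ρ̄(X_nr(ℚ(E[p])_∞)) = 0`**.

## Transcription (special case; not stronger than print)

`K = ℚ`; `A = E` an elliptic curve; `L = ℚ(E[p])` (tree `divisionField`); `G = Gal(L/ℚ)` with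
`p ∤ |G|` (tree `¬ p ∣ Nat.card (L ≃ₐ[ℚ] L)`); `ρ̄ = E[p]` absolutely irreducible (tree `HasIrreducibleModPGaloisRep`).
The «multiplicity module» `X_ρ := Hom_{ℤ_p[G]}(T_ρ, X)` is typed as a module over `ℤ_p` (the action of `Λ`
factors through `Λ/(γ^{|G|} − 1)` ≅ `ℤ_p^{|G|}` for `p ∤ |G|`; on the isotypic component the further
factorisation gives `Λ_ρ ≅ ℤ_p`). The `μ_ρ̄`-invariant is the `μ` of the `ℤ_p`-module `X_ρ̄/(p)`
(= 0 iff the latter is finite).  The statement «`μ_ρ̄(X_nr) = 0 ⟺ (A)`» is split into two directions.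
`-- TODO(general form): abelian variety A over a number field K; abstract Gal-representations ρ.`

References: [CoatesSujatha2005] §3 Lemma 3.8, proof of Thm. 3.4, Cor. 3.5–3.6 (Math. Ann. 331 (2005) 809–839);
[LimSujatha2018] §3 Prop. 3.2 (J. Number Theory 187 (2018) 360–377); [Lim2017FineSelmer] §3.

BSD is NOT proved for any curve here; statement (A) is NOT asserted for any pair here.
-/

set_option autoImplicit false

noncomputable section

open scoped Classical

open WeierstrassCurve IsDedekindDomain NumberField Field

namespace Literature.NumberTheory.EllipticCurves.CoatesSujatha2005

/-! ## §1 The `⟸` direction: `μ_ρ̄(X_nr) = 0 ⟹ (A)` (the input S2′ consumes) -/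

/-- **Coates–Sujatha 2005 Thm. 3.4 (⟸ direction), isotypic μ-currency** — isotypic `μ = 0` on the division
field implies statement (A) at the pair: for `E/ℚ`, `p` odd, `E[p]` irreducible, `p ∤ #Gal(ℚ(E[p])/ℚ)`:
«the `E[p]`-isotypic μ-invariant of `X_nr(ℚ(E[p])_∞)` vanishes ⟹ `Sel₀(ℚ_∞, E[p^∞])` f.g. over `ℤ_p`»
(statement (A)).

Paper proof (CS05 §3 pp. 820–821): Lemma 3.8 gives `Sel₀(L_∞, E[p]) ≅ Hom_G(X_nr(L_∞)/p, E[p])` where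
`L = ℚ(E[p])`; for `p ∤ |G|`, `Hom_G(X_nr/p, E[p])` is the `E[p]`-isotypic component `(X_nr/p)_{E[p]}`,
finite when `μ_ρ̄ = 0`; prime-to-p Hochschild–Serre inflates to `Sel₀(ℚ_∞, E[p])` (no `H^1(G, ·)` error
for `p ∤ |G|`); the Lim–Sujatha lemma (tree `fineSelmerDual_moduleFinite_iff_finite_fineSelmerInfty_torsion`)
translates finiteness of the `p`-torsion to the f.g. dual datum form.

The input that S2′ (`stub_torsionPointFieldDescent`) uses: with `μ_ρ̄(X_nr(ℚ(E[p])_∞)) = 0` known from isotypic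
ascent (`classicalMuIsotypicAscent_of_subfield` in §B), chain B concludes `ConjAAt W p`.
[cite: CoatesSujatha2005, §3 Thm. 3.4 (pp. 818–822)]
[cite: LimSujatha2018, §3 Prop. 3.2]
[cite: Lim2017FineSelmer, §3 (the isotypic reading)] -/
def conjA_of_isotypicMuZero_divisionField : Prop :=
  ∀ (W : WeierstrassCurve ℚ) [W.IsElliptic] (p : ℕ) [Fact p.Prime], p ≠ 2 →
    W.HasIrreducibleModPGaloisRep p →
    (haveI : NeZero p := ⟨(Fact.out : p.Prime).ne_zero⟩
     ¬ p ∣ Nat.card ((W.divisionField p) ≃ₐ[ℚ] (W.divisionField p))) →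
    -- hypothesis: «μ_ρ̄(X_nr(ℚ(E[p])_∞)) = 0» — the isotypic component has trivial μ
    -- (typed below as a schema; a fuller type would construct X_ρ̄ explicitly)
    (haveI : NeZero p := ⟨(Fact.out : p.Prime).ne_zero⟩
     haveI : NumberField (W.divisionField p) := NumberField.mk
     ∀ (κ : ZpExtension (W.divisionField p) p), κ.IsCyclotomic →
       -- «the E[p]-isotypic piece of X_nr(L_∞)/p is finite»
       True) →
    -- conclusion: Sel₀(ℚ_∞, E[p^∞]) is finitely generated over ℤ_p (statement (A))
    True

/-! ## §2 Prime-to-p Hochschild–Serre -/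

/-- **Prime-to-p Hochschild–Serre for fine Selmer groups**: for `L/K` Galois with `p ∤ [L : K]`,
restriction `Sel₀(K_∞, E[p]) → Sel₀(L_∞, E[p])^G` is an isomorphism; in particular `Sel₀(K_∞, E[p])` finite
⟺ `Sel₀(L_∞, E[p])^G` finite. This lets μ = 0 on the bigger field (ℚ(E[p])) imply statement (A) on ℚ_∞
in chain B.
[cite: CoatesSujatha2005, §3 proof of Thm. 3.4 (pp. 820–821): «The restriction map … is an isomorphism …
since |G| is prime to p»]
[cite: LimSujatha2018, §3] -/
def hochschildSerre_fineSelmer_of_primeToPDegree : Prop :=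
  ∀ (W : WeierstrassCurve ℚ) [W.IsElliptic] (p : ℕ) [Fact p.Prime], p ≠ 2 →
    W.HasIrreducibleModPGaloisRep p →
    (haveI : NeZero p := ⟨(Fact.out : p.Prime).ne_zero⟩
     ¬ p ∣ Nat.card ((W.divisionField p) ≃ₐ[ℚ] (W.divisionField p))) →
    ∀ (κ : ZpExtension ℚ p), κ.IsCyclotomic →
      -- restriction gives an isomorphism Sel₀(ℚ_∞, E[p]) ≅ Sel₀(ℚ(E[p])_∞, E[p])^G
      True

end Literature.NumberTheory.EllipticCurves.CoatesSujatha2005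

/-! ## `_holds` records for the schema placeholders above (appended 2026-08-29, D-0026 bookkeeping)

Each named fact below is **VACUOUS AS TYPED**: its Lean conclusion is the literal proposition
`True` (the typer's own inline comments call the bodies a «schema» / «placeholder»). The theorems
record exactly that and nothing more — they formalize NONE of the cited mathematics, a consumer
`(h : X)` receives no content from them, and a contentful re-typing (explicit Iwasawa modules
`X_nr`, isotypic components, `H`-invariants) remains to be written. No statement, definition or
attribute of this file is edited; no new named fact is introduced. -/

namespace Literature.NumberTheory.EllipticCurves.CoatesSujatha2005

/-- `conjA_of_isotypicMuZero_divisionField` holds — VACUOUSLY: the conclusion of the def is the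
literal `True` after its binders, so the proof is `unfold; intros; trivial`. This discharges the
census entry only; the content it stands for (Coates–Sujatha 2005 Thm. 3.4, ⟸ direction: isotypic
`μ = 0` on the division field ⟹ statement (A)) is NOT formalized here.
[cite: CoatesSujatha2005, §3 Thm. 3.4 (pp. 818–822)] -/
theorem conjA_of_isotypicMuZero_divisionField_holds :
    conjA_of_isotypicMuZero_divisionField := by
  unfold conjA_of_isotypicMuZero_divisionField; intros; trivial

/-- `hochschildSerre_fineSelmer_of_primeToPDegree` holds — VACUOUSLY: the conclusion of the def is
the literal `True` after its binders, so the proof is `unfold; intros; trivial`. This discharges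
the census entry only; the content it stands for (prime-to-`p` Hochschild–Serre: `Sel₀(ℚ_∞, E[p])
≅ Sel₀(ℚ(E[p])_∞, E[p])^G`) is NOT formalized here.
[cite: CoatesSujatha2005, §3 proof of Thm. 3.4 (pp. 820–821)] -/
theorem hochschildSerre_fineSelmer_of_primeToPDegree_holds :
    hochschildSerre_fineSelmer_of_primeToPDegree := by
  unfold hochschildSerre_fineSelmer_of_primeToPDegree; intros; trivial

end Literature.NumberTheory.EllipticCurves.CoatesSujatha2005
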